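import Mathlib.Topology.MetricSpace.Basic
import Mathlib.Topology.MetricSpace.ProperSpace
import Mathlib.Analysis.Complex.Basic

/-!
# Fibres of a relatively proper map vary upper semicontinuously

Crux `WitnessCharge` (stmt-SmoothPoincare4-7824), line `Sketch`,
stub `helper_properHolo_upperSemicontinuous` (degree theory of proper holomorphic maps, part 1).

In Gromov's pencil argument the flat coordinate `z ∘ u` of a pencil member is a proper holomorphic
map onto the exterior of a disc; the step "proper holomorphic + one simple single-point fibre ⇒
biholomorphic" is assembled from four parts, of which this file is the purely topological first
one: for `Z` continuous on `U`, mapping `U` into the open set `A`, and RELATIVELY PROPER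
(`U ∩ Z ⁻¹' K` compact for every compact `K ⊆ A`), the fibres over points near `a₁ ∈ A` lie inside
any open `V` containing the fibre over `a₁`.

Proof: choose `ρ > 0` with `closedBall a₁ ρ ⊆ A`; then `L := U ∩ Z ⁻¹' closedBall a₁ ρ` is
compact, so is `L \ V`, and `Z` is continuous on `L \ V ⊆ U`; hence `Z '' (L \ V)` is compact,
thus closed, and it misses `a₁` (the fibre over `a₁` lies in `V`).  The neighbourhood
`W := ball a₁ ρ ∩ (Z '' (L \ V))ᶜ` of `a₁` works: it lies in `closedBall a₁ ρ ⊆ A`, and for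
`a ∈ W`, `ξ ∈ U` with `Z ξ = a` we get `ξ ∈ L`, so `ξ ∉ V` would put `a = Z ξ` in `Z '' (L \ V)`.
-/

noncomputable section

set_option linter.dupNamespace false

open Set Filter Topology Metric

namespace Summit.SmoothPoincare4.SmoothPoincare4.Theorems.WitnessCharge.PencilIncompleteness

/-- **Fibres of a relatively proper map vary upper semicontinuously.** Let `Z : ℂ → ℂ` be
continuous on `U` and map `U` into the open set `A`, and suppose `Z` is relatively proper over
`A` (`U ∩ Z ⁻¹' K` is compact for every compact `K ⊆ A`). If the fibre `U ∩ Z ⁻¹' {a₁}` over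
`a₁ ∈ A` is contained in an open set `V`, then so is the fibre `U ∩ Z ⁻¹' {a}` for every `a` in
some neighbourhood `W ⊆ A` of `a₁`. -/
theorem helper_properHolo_upperSemicontinuous :
    ∀ (Z : ℂ → ℂ) (U A : Set ℂ), IsOpen A → ContinuousOn Z U → MapsTo Z U A →
      (∀ K ⊆ A, IsCompact K → IsCompact (U ∩ Z ⁻¹' K)) →
      ∀ a₁ ∈ A, ∀ V : Set ℂ, IsOpen V → U ∩ Z ⁻¹' {a₁} ⊆ V →
        ∃ W ∈ 𝓝 a₁, W ⊆ A ∧ ∀ a ∈ W, U ∩ Z ⁻¹' {a} ⊆ V := by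
  intro Z U A hA hZ _ hprop a₁ ha₁ V hV hfib
  -- a closed ball around `a₁` inside the open set `A`
  obtain ⟨ρ, hρ, hρA⟩ := Metric.nhds_basis_closedBall.mem_iff.1 (hA.mem_nhds ha₁)
  -- the part of `U` over it is compact (relative properness), and so is its trace outside `V`
  have hLV : IsCompact ((U ∩ Z ⁻¹' closedBall a₁ ρ) \ V) :=
    (hprop _ hρA (isCompact_closedBall a₁ ρ)).diff hV
  -- the image of that trace is compact, hence closed, and misses `a₁`
  have hIm : IsCompact (Z '' ((U ∩ Z ⁻¹' closedBall a₁ ρ) \ V)) :=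
    hLV.image_of_continuousOn (hZ.mono fun ξ hξ => hξ.1.1)
  have ha₁Im : a₁ ∉ Z '' ((U ∩ Z ⁻¹' closedBall a₁ ρ) \ V) := by
    rintro ⟨ξ, hξ, hξa⟩
    exact hξ.2 (hfib ⟨hξ.1.1, hξa⟩)
  refine ⟨ball a₁ ρ ∩ (Z '' ((U ∩ Z ⁻¹' closedBall a₁ ρ) \ V))ᶜ,
    inter_mem (ball_mem_nhds a₁ hρ) (hIm.isClosed.isOpen_compl.mem_nhds ha₁Im),
    fun a ha => hρA (ball_subset_closedBall ha.1), ?_⟩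
  rintro a ⟨haρ, haIm⟩ ξ ⟨hξU, hξa⟩
  have hξa' : Z ξ = a := hξa
  by_contra hξV
  refine haIm ⟨ξ, ⟨⟨hξU, ?_⟩, hξV⟩, hξa'⟩
  rw [mem_preimage, hξa']
  exact ball_subset_closedBall haρ

end Summit.SmoothPoincare4.SmoothPoincare4.Theorems.WitnessCharge.PencilIncompleteness
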